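import Summits.BirchSwinnertonDyer.Rank1Residual.X1.FactorSqueeze
import HarnessLib

/-!
# Route E, part 1 — EISENSTEIN constant term: `ord_p c₀(ϖ·L_p(E,T)) = 1` ⇒ NO proper `Λ`-divisor
# (the divisor set `{0, λ_an}` of route N, PROVED in `Λ` without Weierstrass preparation)

HONEST FRAMING (cell `b2b-bsdres`, run/shared/lean/b2b/bsd-rank1-residual/, verbatim in every
file): the goal of the cell is to DELETE the COMBINATION-SHAPED residual classes of the
Birch–Swinnerton-Dyer formula for ALL analytic-rank `≤ 1` elliptic curves over `ℚ` — "full BSD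
formula for every rank `≤ 1` curve in class `C`" assembled STRICTLY from published theorems — so
that the rank-`≤ 1` remainder becomes exactly the CONSTRUCTION-SHAPED classes, which are TYPED
(missing-input `Prop`s), NOT attempted. This is not "finishing BSD". Sub-cell
`b2b-bsdres-eisenstein-p1` (CLASS-OWNERS row "X1 (r=0)"), gen 11: research route; NO CLAIM BEYOND
STATED CLASSES; nothing here changes a label. ONE typed def (`AnalyticConstCoeffVal`, "`ord_p` of
the constant term of `ϖ·L_p(E,T)` is `v`", nothing asserted — the same KIND of per-pair datum as
`AnalyticMuLE` / `AnalyticLambdaEq`: one coefficient of the `p`-adic `L`-function); everything else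
is a theorem over PUBLISHED named facts already used by `X1/FactorSqueeze.lean`.

WHY THIS FILE. Route N (`X1/FactorSqueeze.lean`, gen 10) types the factorisation pattern of the
analytic distinguished polynomial as `AnalyticLamDivisorSet W p A` with a SHAPE-ONLY citation
(Weierstrass preparation + unique factorisation, [Washington1997] Thm. 7.3 / Prop. 7.6). In the
census most closing patterns are EISENSTEIN (`ord_p c₀ = 1`, `c_λ` the first unit coefficient), and
for that case no preparation theorem is needed: in `Λ = ℤ_p⟦T⟧`, if `g·h` has constant term of
valuation `1` then one of `g(0)`, `h(0)` is a `p`-adic unit, so one of `g`, `h` is a unit of `Λ`, so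
`λ(g) ∈ {0, λ(g·h)}` (§1, PROVED). Hence `AnalyticConstCoeffVal W p 1 ∧ AnalyticLambdaEq W p n ⇒
AnalyticLamDivisorSet W p {0, n}` (§3): the Eisenstein closures of route N (`26b@7`, `4045a@3`,
`7882a@3`, `12470b@3` λ 12, `15515a@3` λ 20, …) no longer rest on a shape-only typed input. The
sequel `X1/ConstantTermSqueeze.lean` proves MORE from the constant term alone (`ord_p c₀ ≤ b(E) ⇒`
Mazur's main conjecture, no `λ_an`/`μ_an`/parity/lower bound) and the honest link
`ord_p c₀ = b(E) + ord_p #Ш(E/ℚ)_an` (so every Eisenstein closure is a `p ∤ #Ш_an` pair).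

* §1 `isUnit_of_valuation_constantCoeff_eq_zero`, `lam_eq_zero_of_valuation_constantCoeff_eq_zero`,
  `lam_eq_zero_or_of_valuation_constantCoeff_mul_eq_one`,
  `lam_eq_zero_or_eq_of_valuation_constantCoeff_mul_eq_one` (Λ-algebra, PROVED).
* §2 `AnalyticConstCoeffVal W p v` (TYPED), `AnalyticConstCoeffVal.valuation_constantCoeff_eq`.
* §3 `analyticLamDivisorSet_pair_of_constCoeffVal_one`; `Leaf.bsdp_of_muZero_of_constCoeffVal_one`.

References: [GreenbergLNM1716] §5 p. 131 ("`f_E(0) ∼ 7` … implies that `f_E(T)` is an irreducible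
element of `Λ`"), p. 183; [Washington1997] §7.1; [MazurTateTeitelbaum1986Invent] §I.14 (14.3);
[Wuthrich2014] Thm. 16; HOME/b2b-bsdres-eisenstein-p1/X1R0-GAPMAP.md §19–§20.
-/

noncomputable section

open scoped Classical MatrixGroups ModularForm

open PowerSeries CongruenceSubgroup WeierstrassCurve Literature.NumberTheory.EllipticCurves
  Literature.NumberTheory.EllipticCurves.ModularForms
  Literature.NumberTheory.EllipticCurves.Rank1Residual
  Literature.NumberTheory.EllipticCurves.Greenberg1999
  Summit.BirchSwinnertonDyer.BirchSwinnertonDyer.Theorems.Rank1ResidualX1Defs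
  Summit.BirchSwinnertonDyer.Rank1Residual.X1.MuLambda
  Summit.BirchSwinnertonDyer.Rank1Residual.X1.MuPart
  Summit.BirchSwinnertonDyer.Rank1Residual.X1.ParitySqueeze
  Summit.BirchSwinnertonDyer.Rank1Residual.X1.TamagawaSqueeze
  Summit.BirchSwinnertonDyer.Rank1Residual.X1.FactorSqueeze

set_option autoImplicit false

namespace Summit.BirchSwinnertonDyer.Rank1Residual.X1.EisensteinSqueeze

/-! ## §1. `Λ`-algebra: a constant term of valuation `0` or `1` -/

section Algebra

variable {p : ℕ} [Fact p.Prime]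

/-- **A power series over `ℤ_p` whose constant term is a `p`-adic unit is a unit of `Λ = ℤ_p⟦T⟧`**
(Washington §7.1; `PowerSeries.isUnit_iff_constantCoeff`). [cite: Washington1997, §7.1] -/
theorem isUnit_of_valuation_constantCoeff_eq_zero {g : IwasawaAlgebra p}
    (hg0 : constantCoeff g ≠ 0) (hv : ((constantCoeff g : ℤ_[p]) : ℚ_[p]).valuation = 0) :
    IsUnit g := by
  rw [PowerSeries.isUnit_iff_constantCoeff, PadicInt.isUnit_iff,
    PadicInt.norm_eq_zpow_neg_valuation hg0]
  have h0 : (constantCoeff g : ℤ_[p]).valuation = 0 := by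
    have e := PadicInt.valuation_coe (constantCoeff g : ℤ_[p])
    rw [hv] at e
    exact_mod_cast e.symm
  rw [h0]
  simp

/-- **A power series over `ℤ_p` whose constant term is a `p`-adic unit has `λ = 0`.**
[cite: Washington1997, §7.1] -/
theorem lam_eq_zero_of_valuation_constantCoeff_eq_zero {g : IwasawaAlgebra p}
    (hg0 : constantCoeff g ≠ 0) (hv : ((constantCoeff g : ℤ_[p]) : ℚ_[p]).valuation = 0) :
    lam g = 0 :=
  lam_eq_zero_of_isUnit (isUnit_of_valuation_constantCoeff_eq_zero hg0 hv)

/-- **Eisenstein dichotomy in `Λ`.** If the constant term of `g·h` has `p`-adic valuation `1`, then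
`g(0)·h(0)` has valuation `1 = ord_p g(0) + ord_p h(0)` with both summands `≥ 0`, so one of `g(0)`,
`h(0)` is a unit and that factor has `λ = 0`. (Greenberg, LNM 1716 p. 131: "`f_E(0) ∼ p` … implies
that `f_E(T)` is an irreducible element of `Λ`".) [cite: GreenbergLNM1716, §5 p. 131]
[cite: Washington1997, §7.1] -/
theorem lam_eq_zero_or_of_valuation_constantCoeff_mul_eq_one {g h : IwasawaAlgebra p}
    (hv : ((constantCoeff (g * h) : ℤ_[p]) : ℚ_[p]).valuation = 1) : lam g = 0 ∨ lam h = 0 := by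
  have hne : constantCoeff (g * h) ≠ 0 := by
    intro h0
    rw [h0, PadicInt.coe_zero, Padic.valuation_zero] at hv
    exact zero_ne_one hv
  rw [map_mul] at hne hv
  have hg0 : constantCoeff g ≠ 0 := fun h0 ↦ hne (by rw [h0, zero_mul])
  have hh0 : constantCoeff h ≠ 0 := fun h0 ↦ hne (by rw [h0, mul_zero])
  rw [PadicInt.coe_mul, Padic.valuation_mul (PadicInt.coe_ne_zero.mpr hg0)
    (PadicInt.coe_ne_zero.mpr hh0)] at hv
  have hg := PadicInt.valuation_coe_nonneg (x := constantCoeff g)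
  have hh := PadicInt.valuation_coe_nonneg (x := constantCoeff h)
  rcases Int.le_iff_eq_or_lt.mp hg with hg' | hg'
  · exact Or.inl (lam_eq_zero_of_valuation_constantCoeff_eq_zero hg0 hg'.symm)
  · right
    exact lam_eq_zero_of_valuation_constantCoeff_eq_zero hh0 (by omega)

/-- **Eisenstein dichotomy for `λ`: `λ(g) ∈ {0, λ(g·h)}`** when `ord_p` of the constant term of
`g·h` is `1` (`λ` is additive on nonzero elements of the domain `Λ`, `MuLambda.lam_mul`).
[cite: GreenbergLNM1716, §5 p. 131] [cite: Washington1997, §7.1] -/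
theorem lam_eq_zero_or_eq_of_valuation_constantCoeff_mul_eq_one {g h : IwasawaAlgebra p}
    (hv : ((constantCoeff (g * h) : ℤ_[p]) : ℚ_[p]).valuation = 1) :
    lam g = 0 ∨ lam g = lam (g * h) := by
  have hne : g * h ≠ 0 := by
    intro h0
    rw [h0, map_zero, PadicInt.coe_zero, Padic.valuation_zero] at hv
    exact zero_ne_one hv
  have hg : g ≠ 0 := fun h0 ↦ hne (by rw [h0, zero_mul])
  have hh : h ≠ 0 := fun h0 ↦ hne (by rw [h0, mul_zero])
  rcases lam_eq_zero_or_of_valuation_constantCoeff_mul_eq_one hv with h0 | h0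
  · exact Or.inl h0
  · right
    rw [lam_mul hg hh, h0, add_zero]

end Algebra

/-! ## §2. "`ord_p` of the constant term of `ϖ·L_p(E,T)` is `v`", TYPED (nothing asserted) -/

/-- **"`ord_p c₀(ϖ·L_p(E,T)) = v`" (TYPED; nothing asserted).** For the newform `f` of `E` at level
`N_E` and every rational `ϖ` with `ϖ·Ω_E = Ω⁺_f` (the Néron normalisation of `X1/MuLambda.lean`):
the constant term `c₀ = ϖ · L_p(f,α)(0)` (`α` the unit root) has `p`-adic valuation `v`. A FINITE
per-pair datum of the same kind as `AnalyticMuLE` / `AnalyticLambdaEq` (one coefficient of the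
`p`-adic `L`-function). TIER, stated honestly: by the interpolation formula `c₀ = ϖ (1 − α⁻¹)² [0]⁺_f`
(tree theorem `constantCoeff_padicLFunction_unitRoot`, Mazur–Tate–Teitelbaum (14.3)) with
`ord_p(1 − α⁻¹) = ord_p #Ẽ(𝔽_p)` (`exists_unit_one_sub_unitRoot_inv`) and `ϖ[0]⁺_f = L(E,1)/Ω_E`,
`v` is the exact integer `2·ord_p #Ẽ(𝔽_p) + ord_p (L(E,1)/Ω_E) = b(E) + ord_p #Ш(E/ℚ)_an`
(`b(E) = ord_p ∏ c_ℓ + 2·ord_p #Ẽ(𝔽_p) − 2·ord_p #E(ℚ)_tors`) whenever `L(E,1) ≠ 0` — the same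
rational number Cremona's `allbsd` tabulates; in the census it is certified by the iw engines' `v_c0`
column (exact modular symbols) and independently by `allbsd`. `v = 1` with `λ_an ≥ 1` is the
EISENSTEIN case of route N; `v ≤ b(E)` is `p ∤ #Ш(E/ℚ)_an`.
[cite: MazurTateTeitelbaum1986Invent, §I.14 (14.3) (shape only; nothing asserted)] -/
def AnalyticConstCoeffVal (W : WeierstrassCurve ℚ) [W.IsElliptic] [W.IsGloballyMinimal] (p : ℕ)
    [Fact p.Prime] (v : ℤ) : Prop :=
  ∀ [NeZero (W.conductorNorm ℤ)] (f : CuspForm (Gamma0 (W.conductorNorm ℤ)) 2),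
    IsNewformOf W f → ∀ (ϖ : ℚ), (ϖ : ℝ) * W.realPeriodRat = plusPeriod f →
      ((ϖ : ℚ_[p]) * PowerSeries.constantCoeff
        (padicLFunction f (unitRoot W p : ℚ_[p]))).valuation = v

section Basic

variable {W : WeierstrassCurve ℚ} [W.IsElliptic] [W.IsGloballyMinimal] {p : ℕ} [Fact p.Prime]

/-- Reading the typed constant-term valuation on a `Λ`-factorisation `ι(g) = ϖ·L_p`: the constant
term of `g ∈ Λ` has valuation `v` (`ι` preserves constant terms, `constantCoeff_iwasawaToPowerSeries`).
[folklore] -/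
theorem AnalyticConstCoeffVal.valuation_constantCoeff_eq {v : ℤ} (hc : AnalyticConstCoeffVal W p v)
    [NeZero (W.conductorNorm ℤ)] {f : CuspForm (Gamma0 (W.conductorNorm ℤ)) 2} (hf : IsNewformOf W f)
    {ϖ : ℚ} (hϖ : (ϖ : ℝ) * W.realPeriodRat = plusPeriod f) {g : IwasawaAlgebra p}
    (hι : iwasawaToPowerSeries p g = C (ϖ : ℚ_[p]) * padicLFunction f (unitRoot W p : ℚ_[p])) :
    ((constantCoeff g : ℤ_[p]) : ℚ_[p]).valuation = v := by
  rw [← constantCoeff_iwasawaToPowerSeries p g, hι, map_mul, constantCoeff_C]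
  exact hc f hf ϖ hϖ

end Basic

/-! ## §3. Eisenstein ⇒ the divisor set `{0, λ_an}` of route N (no Weierstrass preparation needed) -/

section DivisorSet

variable {W : WeierstrassCurve ℚ} [W.IsElliptic] [W.IsGloballyMinimal] {p : ℕ} [Fact p.Prime]

/-- **Eisenstein ⇒ `AnalyticLamDivisorSet W p {0, n}`.** If `λ_an(E,p) = n` (`AnalyticLambdaEq W p n`)
and `ord_p c₀(ϖ·L_p) = 1` (`AnalyticConstCoeffVal W p 1`), then every `Λ`-divisor `g` of `ϖ·L_p`
(`ι(g·h) = ϖ·L_p`) has `λ(g) ∈ {0, n}` — §1 applied to `g·h`. This DISCHARGES route N's shape-only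
typed input in the Eisenstein case. [cite: GreenbergLNM1716, §5 p. 131] [cite: Washington1997, §7.1] -/
theorem analyticLamDivisorSet_pair_of_constCoeffVal_one {n : ℕ} (hlam : AnalyticLambdaEq W p n)
    (hc : AnalyticConstCoeffVal W p 1) : AnalyticLamDivisorSet W p {0, n} := by
  intro _ f hf ϖ hϖ g h hι
  have hv : ((constantCoeff (g * h) : ℤ_[p]) : ℚ_[p]).valuation = 1 :=
    hc.valuation_constantCoeff_eq hf hϖ hι
  have hn : lam (g * h) = n := hlam f hf ϖ hϖ (g * h) hι
  rcases lam_eq_zero_or_eq_of_valuation_constantCoeff_mul_eq_one hv with h0 | h0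
  · exact Or.inl h0
  · right; rw [Set.mem_singleton_iff, h0, hn]

/-- **Route E on the leaf via route N: `μ_an = 0 ∧ λ_an = n ∧ ord_p c₀ = 1 ∧ λ_alg ≥ 1 ⇒ BSD(E,p)`**
(`FactorSqueeze.Leaf.bsdp_of_muZero_of_irreducible` with the divisor set PROVED, not typed). The
Eisenstein classes of the gen-10 census (`26b@7`, `4045a@3` λ 8, `7882a@3` λ 10, `12470b@3` λ 12,
`15515a@3` λ 20, …) are of this shape. [cite: GreenbergLNM1716, Prop. 3.10, Thm. 4.1, §5 pp. 131, 183]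
[cite: Wuthrich2014, Thm. 16 (p. 397)] -/
theorem Leaf.bsdp_of_muZero_of_constCoeffVal_one
    (hW16 : Wuthrich2014.charIdeal_dvd_padicLFunction) (hGr : greenberg_charValue_rankZero)
    (h310 : prop310_selmerCorank_mod_two_eq_lambdaInvariant)
    (hmod : nonempty_modularParametrizationData)
    (hGZK : rank_eq_analyticRank_of_analyticRank_le_one) (hL : RankZero.Leaf W p)
    (hμ0 : AnalyticMuLE W p 0) {n : ℕ} (hlam : AnalyticLambdaEq W p n)
    (hc : AnalyticConstCoeffVal W p 1) (hk : AlgebraicLambdaGE W p 1) : BSDp W p :=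
  Leaf.bsdp_of_muZero_of_irreducible hW16 hGr h310 hmod hGZK hL hμ0 hlam
    (analyticLamDivisorSet_pair_of_constCoeffVal_one hlam hc) hk

end DivisorSet



end Summit.BirchSwinnertonDyer.Rank1Residual.X1.EisensteinSqueeze

end
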